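import Literature.NumberTheory.Automorphic.ArchSplitPlaceStandardise        -- ★ (e3-5) p850860: `φ_w : archLocal L 3 (diagonal α) w ≃ₜ* U(J₃)(ℂ)` carrying the boost to `diag(boostEig)` ∈ `torusU`; `boostEig`, `boostEig_ne_zero`
import Literature.NumberTheory.Automorphic.ArchInnerFormChartLocal          -- ★ `chartTorusGLoc` (`T′_{S′,w}`), `mem_chartTorusGLoc_iff`, `gprimeBlockAt`, `forall_mem_chartTorusGLoc_comm`
import Literature.NumberTheory.Automorphic.ArchU21SplitIwasawa              -- ★ (e3-1) p850865: `exists_measure_quotient_torusU_complex_three_eq_smul_map` (the `hμC` producer); brings ★ `HeisRing.torus_relations`, `LineRing.forall_mem_torusU_comm`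
import Literature.MeasureTheory.Group.CosetSpaceLpTransport                 -- ★ `smulInvariantMeasure_map_cosetCongr_of_smulInvariantMeasure`, `isFiniteMeasureOnCompacts_map_cosetCongr` (ANY measure); brings ★ `InvariantQuotientTransport` (`cosetCongr`, `cosetCongrHomeomorph`, `cosetCongr_mk`)
import HarnessLib

/-!
# Transport of the local chart quotient `U(α)_w ⧸ T′_{S′,w}` at a split-chart place to the model `U(J₃)(ℂ) ⧸ torusU` along the frame bridge `φ_w`
# (Deitmar–Echterhoff 2014 Thm. 1.5.3; Folland 1995 §2.6; Rogawski 1990 §1.9–§1.10, §3.6; Knapp 1986 V §3)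

Topic `NumberTheory/Automorphic`; namespaces `Literature.NumberTheory.Automorphic` (§3, generic) and `….UnitaryGroup` (§§1, 2, 4).  THEOREMS ONLY (no definition, no instance,
no notation, no axiom, no named fact, no `sorry`); kernel lane `--kind proof --supports stmt-HodgeConjecture-24833`.  Cell `pub/hodgecm-mathlib`, crux H413 (`stmt-HodgeConjecture-24833`),
F0∕P3c line LH3 (closer stub `stub_N9`, N9″ DIRECT ROAD), LETTER L1 `HcOrbitalFamiliesStatement`, clause (I₂) «`orbFamGExt ν′ a′ S′` is `C^∞` on `InRegG s S′`», E3 §4 ASSEMBLY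
«GLOBAL PARABOLIC DESCENT AT THE SPLIT PLACES» (spec `F0/P3/F0P3b-p01/g16/SPEC-E3-assembly.v1.md` 8b41e07400b06e90, LH3-plan (g3) RULING #13 2026-09-02T09:57:12Z), brick **(A2) «LOCAL
TRANSPORT to `U(J₃)(ℂ) ⧸ torusU`»** (seat LH10-p01 (g4)).

THE MATHEMATICS.  At a split-chart place `w ∈ S′` of the house frame (`hα : ∀ i, α i ≠ 0`, `S′` admissible), the letter's local factor is the quotient orbital integral
`∫_{U(α)_w ⧸ T′_{S′,w}} f(y · gprimeBlockAt cw · y⁻¹)` over the local chart torus `T′_{S′,w} = chartTorusGLoc L α w S′` (the boost Cartan; ★ `ArchInnerFormChartLocal`), whereas the E3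
engine ((e3-1) ★ `ArchU21SplitIwasawa`, (e3-3) ★ `ArchU21SplitOrbitDescent`, (e3-4a∕b)) is typed on the MODEL `U(J₃)(ℂ) ⧸ torusU` with the DIAGONAL split Cartan.  ★ (e3-5)
`ArchSplitPlaceStandardise` supplies one fixed `φ_w : U(α)_w ≃ₜ* U(J₃)(ℂ)` with `φ_w (gprimeBlock α w S′ c) = diag(boostEig (c w)) ∈ torusU`.  THIS FILE proves the one missing fact and
does the bookkeeping:
* §1 **`c ↦ diag(boostEig c) = diag(e^{x+iθ}, e^{iφ}, e^{−x+iθ})` is ONTO `torusU(J₃)(ℂ)`** (`exists_boostEig_eq_of_mem_torusU`): for `t = diag(d) ∈ torusU` the torus relations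
  `σ(d₁) d₁ = 1`, `σ(d₀) d₂ = 1` (★ `HeisRing.torus_relations`) give `d₀ = e^{log‖d₀‖ + i arg d₀}`, `d₁ = e^{i arg d₁}`, `d₂ = σ(d₀)⁻¹ = e^{−log‖d₀‖ + i arg d₀}` (Mathlib `Complex.exp_log`,
  `Complex.exp_conj`).
* §2 hence **`φ_w` carries `T′_{S′,w}` EXACTLY onto `torusU`**: `φ_w g ∈ torusU ↔ g ∈ chartTorusGLoc L α w S′` for every admissible `S′ ∋ w` (`⊆`: ★ `mem_chartTorusGLoc_iff` + (e3-5)'s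
  clause; `⊇`: §1 + injectivity of `φ_w`) — the `hHH′` binder of ★ `InvariantQuotientTransport.cosetCongr` (`exists_continuousMulEquiv_archLocal_splitChart_torusU`, re-exporting (e3-5)'s
  clauses so ONE `obtain` serves).
* §3 (generic, any bicontinuous `e : G ≃* G′` with `e⁻¹(H′) = H`, ANY subgroups `H`, `H′` and ANY measure `μ` on `G ⧸ H` — ★ `InvariantQuotientTransport` has these for the canonical
  `quotientMeasure` only, ★ `CosetSpaceLpTransport` the invariance ∕ Radon transport for any measure (used by name), ★ `OrbitalEulerProductModel` the orbital change of
  variables for CENTRALISER subgroups only; names here carry `_subgroup`): the image `(cosetCongr e)_* μ` of a non-zero measure is non-zero, the orbital integrand transports POINTWISE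
  (`descConj (e γ) H′ F ∘ cosetCongr e = descConj γ H (F ∘ e)`), and the changes of variables `∫⁻`∕`∫` (no integrability hypothesis).
* §4 the PACKAGE at the split place (`exists_splitPlace_transport`): `φ`, the homeomorphism `Ψ = cosetCongr φ : U(α)_w ⧸ T′ ≃ U(J₃) ⧸ torusU`, the torus clause `glDiagonal 3 ℂ (boostEig cw) =
  ↑(φ (gprimeBlockAt cw)) ∈ torusU` ((e3-3)'s `hd`∕`ht`), measure transport (§3) and the orbital identity
  **`∫_{U(α)_w ⧸ T′} (F ∘ φ)(y · gprimeBlockAt cw · y⁻¹) dμ = ∫_{U(J₃) ⧸ torusU} F(y · φ(gprimeBlockAt cw) · y⁻¹) d(Ψ_* μ)`**; and the `hμC` HOOKUP with ★ (e3-1): `Ψ_* μ = C • ((k,n) ↦ k n T)_*(κ ⊗ μ_N)`,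
  `0 < C`, for every compact `K ≤ U(J₃)` with `U(J₃) = K B` (`exists_splitPlace_transport_smul_map`).  So (A3)∕(A5) read each split factor in E3's currency with `F` living on the model and the
  letter's integrand entering as `F ∘ φ_w`.
HONEST LABEL: HC_CM is proved only modulo the 7 printed citations (2 remaining: hLiu418 = `stmt-HodgeConjecture-24832`, h413 = `stmt-HodgeConjecture-24833`) until rung 0 closes;
measure∕matrix bookkeeping over Mathlib + ★ kit, count-neutral, pays nothing by itself (a letter-L1 (I₂) assembly brick).

References: [DeitmarEchterhoff2014] A. Deitmar, S. Echterhoff, *Principles of Harmonic Analysis*, 2nd ed. (2014), Thm. 1.5.3 · [Folland1995] G. B. Folland, *A Course in Abstract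
Harmonic Analysis* (1995), §2.6 Thm. 2.49 · [Rogawski1990] J. D. Rogawski, *Automorphic Representations of Unitary Groups in Three Variables*, Ann. of Math. Stud. 123 (1990), §1.9 p. 8,
§1.10 p. 9, §3.6 p. 31, §4.13 pp. 64–67 · [Knapp1986] A. W. Knapp, *Representation Theory of Semisimple Groups* (1986), Ch. V §3 · [Gelbart1975] S. Gelbart, *Automorphic Forms on Adele
Groups* (1975), Thm. 9.22 (iii), §10 p. 155.
-/

set_option autoImplicit false

noncomputable section

open MeasureTheory Measure Set Filter Topology NumberField NumberField.InfinitePlace Complex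
open scoped ENNReal NNReal ComplexConjugate

namespace Literature.NumberTheory.Automorphic

open Literature.MeasureTheory.Group

/-! ## §3 (generic) Transport of invariant measures and orbital integrands along `cosetCongr e : G ⧸ H ≃ G′ ⧸ H′`, for ANY measure on `G ⧸ H` -/

section GenericTransport

variable {G G' : Type*} [Group G] [Group G'] [TopologicalSpace G] [TopologicalSpace G']
  (e : G ≃* G') (he : Continuous e) (hes : Continuous e.symm)
  (H : Subgroup G) (H' : Subgroup G') (hHH' : ∀ g, e g ∈ H' ↔ g ∈ H)
  [MeasurableSpace (G ⧸ H)] [BorelSpace (G ⧸ H)] [MeasurableSpace (G' ⧸ H')] [BorelSpace (G' ⧸ H')]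

include he in
/-- **The image of a non-zero measure under `cosetCongr e` is non-zero.** [cite: DeitmarEchterhoff2014, Thm. 1.5.3] -/
theorem map_cosetCongr_subgroup_ne_zero {μ : Measure (G ⧸ H)} (hμ : μ ≠ 0) : μ.map (cosetCongr e H H' hHH') ≠ 0 := by
  rw [Ne, Measure.map_eq_zero_iff (continuous_cosetCongr e H H' hHH' he).measurable.aemeasurable]
  exact hμ

omit [TopologicalSpace G] [TopologicalSpace G'] [MeasurableSpace (G ⧸ H)] [BorelSpace (G ⧸ H)] [MeasurableSpace (G' ⧸ H')] [BorelSpace (G' ⧸ H')] in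
/-- **The orbital integrand transports POINTWISE**: `descConj (e γ) H′ F (cosetCongr e x) = descConj γ H (F ∘ e) x` (`e(y γ y⁻¹) = e(y) e(γ) e(y)⁻¹`). [cite: Gelbart1975, §10 p. 155] -/
theorem descConj_cosetCongr_subgroup {α : Type*} {γ : G} (hH : ∀ h ∈ H, h * γ = γ * h) (hH' : ∀ h ∈ H', h * e γ = e γ * h) (F : G' → α) (x : G ⧸ H) :
    descConj (e γ) H' hH' F (cosetCongr e H H' hHH' x) = descConj γ H hH (F ∘ e) x := by
  induction x using QuotientGroup.induction_on with
  | H g => simp only [cosetCongr_mk, descConj_mk, Function.comp_apply, map_mul, map_inv]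

include he hes in
/-- **Change of variables for orbital integrals, `∫⁻` form**: `∫⁻_{G′⧸H′} descConj (e γ) H′ F d((cosetCongr e)_* μ) = ∫⁻_{G⧸H} descConj γ H (F ∘ e) dμ`, for ANY measure `μ`.
[cite: DeitmarEchterhoff2014, Thm. 1.5.3] [cite: Gelbart1975, §10 p. 155] -/
theorem lintegral_descConj_map_cosetCongr_subgroup (μ : Measure (G ⧸ H)) {γ : G} (hH : ∀ h ∈ H, h * γ = γ * h) (hH' : ∀ h ∈ H', h * e γ = e γ * h) (F : G' → ℝ≥0∞) :
    ∫⁻ y, descConj (e γ) H' hH' F y ∂(μ.map (cosetCongr e H H' hHH')) = ∫⁻ x, descConj γ H hH (F ∘ e) x ∂μ := by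
  rw [← coe_cosetCongrHomeomorph e H H' hHH' he hes, ← Homeomorph.toMeasurableEquiv_coe, lintegral_map_equiv]
  refine lintegral_congr fun x => ?_
  rw [Homeomorph.toMeasurableEquiv_coe, coe_cosetCongrHomeomorph, descConj_cosetCongr_subgroup]

include he hes in
/-- **Change of variables for orbital integrals, Bochner form** (Banach-valued, no integrability hypothesis: `MeasureTheory.integral_map_equiv`):
`∫_{G′⧸H′} descConj (e γ) H′ F d((cosetCongr e)_* μ) = ∫_{G⧸H} descConj γ H (F ∘ e) dμ`. [cite: DeitmarEchterhoff2014, Thm. 1.5.3] [cite: Gelbart1975, §10 p. 155] -/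
theorem integral_descConj_map_cosetCongr_subgroup {E : Type*} [NormedAddCommGroup E] [NormedSpace ℝ E] (μ : Measure (G ⧸ H)) {γ : G}
    (hH : ∀ h ∈ H, h * γ = γ * h) (hH' : ∀ h ∈ H', h * e γ = e γ * h) (F : G' → E) :
    ∫ y, descConj (e γ) H' hH' F y ∂(μ.map (cosetCongr e H H' hHH')) = ∫ x, descConj γ H hH (F ∘ e) x ∂μ := by
  rw [← coe_cosetCongrHomeomorph e H H' hHH' he hes, ← Homeomorph.toMeasurableEquiv_coe, integral_map_equiv]
  exact integral_congr_ae (Filter.Eventually.of_forall fun x => descConj_cosetCongr_subgroup e H H' hHH' hH hH' F x)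

end GenericTransport

namespace UnitaryGroup

/-! ## §1 `c ↦ diag(boostEig c)` is onto the diagonal split Cartan `torusU` of `U(J₃)(ℂ)` -/

section TorusOnto

variable {J : Matrix (Fin 3) (Fin 3) ℂ} (hJ : J = (StdForm.antidiagonal 3).over ℂ)

include hJ in
/-- **Every element of the diagonal split Cartan of `U(J₃)(ℂ)` is `diag(e^{x+iθ}, e^{iφ}, e^{−x+iθ})`**: for `t = diag(d) ∈ torusU` the torus relations `σ(d₁) d₁ = 1`,
`σ(d₀) d₂ = 1` (★ `HeisRing.torus_relations`) give `d = boostEig (log ‖d₀‖, arg d₁, arg d₀)` — in the `glDiagonal` currency of ★ (e3-5) ∕ (e3-3)'s `hd`.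
[cite: Rogawski1990, §1.9 p. 8; §1.10 p. 9] [cite: Knapp1986, Ch. V §3] -/
theorem exists_boostEig_eq_of_mem_torusU {t : ↥(unitaryGroupOfForm (starRingEnd ℂ) J)} (ht : t ∈ torusU (starRingEnd ℂ) J) :
    ∃ c : Fin 3 → ℝ, glDiagonal 3 ℂ (fun i => Units.mk0 (boostEig c i) (boostEig_ne_zero c i)) = (t : GL (Fin 3) ℂ) := by
  obtain ⟨d, hd⟩ := (mem_torusU_iff t).1 ht
  obtain ⟨-, h11, h02⟩ := HeisRing.torus_relations (starRingEnd ℂ) hJ ⟨t, ht⟩ hd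
  have hd0 : ((d 0 : ℂˣ) : ℂ) ≠ 0 := (d 0).ne_zero
  have hd1 : ((d 1 : ℂˣ) : ℂ) ≠ 0 := (d 1).ne_zero
  have hn1 : ‖((d 1 : ℂˣ) : ℂ)‖ = 1 := by
    have h : ((‖((d 1 : ℂˣ) : ℂ)‖ : ℂ)) ^ 2 = 1 := by rw [← Complex.conj_mul']; exact h11
    have h' : ‖((d 1 : ℂˣ) : ℂ)‖ ^ 2 = 1 := by exact_mod_cast h
    exact (pow_eq_one_iff_of_nonneg (norm_nonneg _) two_ne_zero).1 h'
  have hd2 : ((d 2 : ℂˣ) : ℂ) = ((starRingEnd ℂ) ((d 0 : ℂˣ) : ℂ))⁻¹ := eq_inv_of_mul_eq_one_right h02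
  refine ⟨![(Complex.log ((d 0 : ℂˣ) : ℂ)).re, (Complex.log ((d 1 : ℂˣ) : ℂ)).im, (Complex.log ((d 0 : ℂˣ) : ℂ)).im], ?_⟩
  rw [← hd]
  congr 1
  funext i
  apply Units.ext
  rw [Units.val_mk0]
  fin_cases i
  · show Complex.exp (((Complex.log ((d 0 : ℂˣ) : ℂ)).re : ℂ) + ((Complex.log ((d 0 : ℂˣ) : ℂ)).im : ℂ) * I) = ((d 0 : ℂˣ) : ℂ)
    rw [Complex.re_add_im, Complex.exp_log hd0]
  · show Complex.exp (((Complex.log ((d 1 : ℂˣ) : ℂ)).im : ℂ) * I) = ((d 1 : ℂˣ) : ℂ)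
    have hre : ((Complex.log ((d 1 : ℂˣ) : ℂ)).re : ℂ) = 0 := by
      rw [Complex.log_re, hn1, Real.log_one, Complex.ofReal_zero]
    rw [show ((Complex.log ((d 1 : ℂˣ) : ℂ)).im : ℂ) * I = ((Complex.log ((d 1 : ℂˣ) : ℂ)).re : ℂ) + ((Complex.log ((d 1 : ℂˣ) : ℂ)).im : ℂ) * I by
        rw [hre, zero_add], Complex.re_add_im, Complex.exp_log hd1]
  · show Complex.exp (-((Complex.log ((d 0 : ℂˣ) : ℂ)).re : ℂ) + ((Complex.log ((d 0 : ℂˣ) : ℂ)).im : ℂ) * I) = ((d 2 : ℂˣ) : ℂ)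
    have hconj : -((Complex.log ((d 0 : ℂˣ) : ℂ)).re : ℂ) + ((Complex.log ((d 0 : ℂˣ) : ℂ)).im : ℂ) * I = -(starRingEnd ℂ) (Complex.log ((d 0 : ℂˣ) : ℂ)) := by
      apply Complex.ext <;> simp
    rw [hconj, Complex.exp_neg, Complex.exp_conj, Complex.exp_log hd0, hd2]

include hJ in
/-- **Matrix form**: every `t ∈ torusU` of `U(J₃)(ℂ)` has underlying matrix `diag(boostEig c)` for some `c`. [cite: Rogawski1990, §1.9 p. 8] [cite: Knapp1986, Ch. V §3] -/
theorem exists_diagonal_boostEig_eq_of_mem_torusU {t : ↥(unitaryGroupOfForm (starRingEnd ℂ) J)} (ht : t ∈ torusU (starRingEnd ℂ) J) :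
    ∃ c : Fin 3 → ℝ, Matrix.diagonal (boostEig c) = ((t : GL (Fin 3) ℂ) : Matrix (Fin 3) (Fin 3) ℂ) := by
  obtain ⟨c, hc⟩ := exists_boostEig_eq_of_mem_torusU hJ ht
  refine ⟨c, ?_⟩
  rw [← hc, coe_glDiagonal]
  rfl

end TorusOnto

/-! ## §2 The frame bridge `φ_w` carries the local chart torus `T′_{S′,w}` exactly onto `torusU` -/

section Frame

variable (L : Type) [Field L] [NumberField L] [IsCMField L] (α : Fin 3 → L) (w : {w : InfinitePlace L // IsComplex w})

/-- **THE FRAME BRIDGE WITH ITS TORUS IMAGE**: at a split-chart place `w` of the house frame there is ONE fixed `φ : U(α)_w ≃ₜ* U(J₃)(ℂ)` (★ (e3-5)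
`exists_continuousMulEquiv_archLocal_splitChart_std`, clauses re-exported: `φ (gprimeBlock α w S′ c) = diag(boostEig (c w))` as a matrix, as `glDiagonal`, and `∈ torusU`; conjugation by a
fixed `T ∈ GL₃(ℂ)`) which moreover carries the local chart torus EXACTLY onto the diagonal split Cartan: **`φ g ∈ torusU ↔ g ∈ chartTorusGLoc L α w S′`** for every admissible `S′ ∋ w` —
the `hHH′` binder of ★ `cosetCongr`. [cite: Rogawski1990, §1.9 p. 8; §3.6 p. 31] [cite: Knapp1986, Ch. V §3] -/
theorem exists_continuousMulEquiv_archLocal_splitChart_torusU (hα : ∀ i, α i ≠ 0) (hsp : w ∈ splitChartPlaces L α)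
    {J : Matrix (Fin 3) (Fin 3) ℂ} (hJ : J = (StdForm.antidiagonal 3).over ℂ) :
    ∃ φ : ↥(archLocal L 3 (Matrix.diagonal α) w) ≃ₜ* ↥(unitaryGroupOfForm (starRingEnd ℂ) J),
      (∀ (S' : Finset {w : InfinitePlace L // IsComplex w}) (c : {w : InfinitePlace L // IsComplex w} → Fin 3 → ℝ), w ∈ S' →
        (((φ (gprimeBlock L α w S' c) : ↥(unitaryGroupOfForm (starRingEnd ℂ) J)) : GL (Fin 3) ℂ) : Matrix (Fin 3) (Fin 3) ℂ) = Matrix.diagonal (boostEig (c w)) ∧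
        glDiagonal 3 ℂ (fun i => Units.mk0 (boostEig (c w) i) (boostEig_ne_zero (c w) i)) = ((φ (gprimeBlock L α w S' c) : ↥(unitaryGroupOfForm (starRingEnd ℂ) J)) : GL (Fin 3) ℂ) ∧
        φ (gprimeBlock L α w S' c) ∈ torusU (starRingEnd ℂ) J) ∧
      (∃ T : GL (Fin 3) ℂ, ∀ h : ↥(archLocal L 3 (Matrix.diagonal α) w),
        ((φ h : ↥(unitaryGroupOfForm (starRingEnd ℂ) J)) : GL (Fin 3) ℂ) = T * (h : GL (Fin 3) ℂ) * T⁻¹) ∧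
      (∀ S' : Finset {w : InfinitePlace L // IsComplex w}, (∀ v, v ∈ S' → v ∈ splitChartPlaces L α) → w ∈ S' →
        ∀ g : ↥(archLocal L 3 (Matrix.diagonal α) w), φ g ∈ torusU (starRingEnd ℂ) J ↔ g ∈ chartTorusGLoc L α w S') := by
  obtain ⟨φ, hφ, hT⟩ := exists_continuousMulEquiv_archLocal_splitChart_std L α w hα hsp hJ
  refine ⟨φ, hφ, hT, fun S' hS' hw g => ⟨fun hg => ?_, fun hg => ?_⟩⟩
  · obtain ⟨c, hc⟩ := exists_boostEig_eq_of_mem_torusU hJ hg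
    have h2 := (hφ S' (fun _ => c) hw).2.1
    have heq : φ g = φ (gprimeBlock L α w S' (fun _ => c)) := by
      apply Subtype.ext
      rw [← hc, ← h2]
    rw [φ.injective heq]
    exact gprimeBlock_mem_chartTorusGLoc L α w S' (fun _ => c)
  · obtain ⟨cw, hcw⟩ := (mem_chartTorusGLoc_iff L α w S' hα hS' g).1 hg
    rw [← hcw]
    exact (hφ S' (fun _ => cw) hw).2.2

end Frame

/-! ## §4 The package at a split place: `Ψ = cosetCongr φ_w : U(α)_w ⧸ T′_{S′,w} ≃ U(J₃)(ℂ) ⧸ torusU`, measure transport, the orbital identity, the `hμC` hookup -/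

section SplitPlace

variable (L : Type) [Field L] [NumberField L] [IsCMField L] (α : Fin 3 → L) (w : {w : InfinitePlace L // IsComplex w})

/-- **LOCAL TRANSPORT TO THE MODEL, BINDER PACKAGE** (brick (A2)).  At a split-chart place `w ∈ S′` (admissible `S′`, `hα`): the frame bridge `φ` (§2) and
`hφT : ∀ g, φ g ∈ torusU ↔ g ∈ T′_{S′,w}`, so that `Ψ := cosetCongr φ T′ torusU hφT` (★ `InvariantQuotientTransport`; a homeomorphism, `Ψ ⟦y⟧ = ⟦φ y⟧`) is available BY NAME, with:
(i) the torus clause at the local chart `gprimeBlockAt α w S′ cw` in (e3-3)'s currencies (`glDiagonal 3 ℂ (boostEig cw) = ↑(φ γ)`, `φ γ ∈ torusU`); (ii) for ANY `U(α)_w`-invariant Radon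
`μ ≠ 0` on `U(α)_w ⧸ T′`, `Ψ_* μ` is `U(J₃)`-invariant, Radon and `≠ 0` (the hypotheses of ★ (e3-1)); (iii) the ORBITAL IDENTITY
**`∫_{U(α)_w ⧸ T′} (F ∘ φ)(y · γ · y⁻¹) dμ = ∫_{U(J₃) ⧸ torusU} F(y · φ γ · y⁻¹) d(Ψ_* μ)`** (Bochner, Banach-valued, no integrability hypothesis) and its `∫⁻` twin;
(iv) the POINTWISE readings `φ (y γ y⁻¹) = φ y · φ γ · (φ y)⁻¹` and `descConj (φ γ) torusU F ∘ Ψ = descConj γ T′ (F ∘ φ)` (so a MEASURE identity + `integral_map` is all (A5) needs).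
[cite: DeitmarEchterhoff2014, Thm. 1.5.3] [cite: Rogawski1990, §3.6 p. 31; §4.13 pp. 64–67] [cite: Knapp1986, Ch. V §3] -/
theorem exists_splitPlace_transport (hα : ∀ i, α i ≠ 0) (hsp : w ∈ splitChartPlaces L α)
    (S' : Finset {w : InfinitePlace L // IsComplex w}) (hS' : ∀ v, v ∈ S' → v ∈ splitChartPlaces L α) (hw : w ∈ S')
    {J : Matrix (Fin 3) (Fin 3) ℂ} (hJ : J = (StdForm.antidiagonal 3).over ℂ)
    [MeasurableSpace ↥(archLocal L 3 (Matrix.diagonal α) w)] [BorelSpace ↥(archLocal L 3 (Matrix.diagonal α) w)]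
    [MeasurableSpace ↥(unitaryGroupOfForm (starRingEnd ℂ) J)] [BorelSpace ↥(unitaryGroupOfForm (starRingEnd ℂ) J)]
    [MeasurableSpace (↥(archLocal L 3 (Matrix.diagonal α) w) ⧸ chartTorusGLoc L α w S')] [BorelSpace (↥(archLocal L 3 (Matrix.diagonal α) w) ⧸ chartTorusGLoc L α w S')]
    [MeasurableSpace (↥(unitaryGroupOfForm (starRingEnd ℂ) J) ⧸ torusU (starRingEnd ℂ) J)] [BorelSpace (↥(unitaryGroupOfForm (starRingEnd ℂ) J) ⧸ torusU (starRingEnd ℂ) J)] :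
    ∃ (φ : ↥(archLocal L 3 (Matrix.diagonal α) w) ≃ₜ* ↥(unitaryGroupOfForm (starRingEnd ℂ) J))
      (hφT : ∀ g : ↥(archLocal L 3 (Matrix.diagonal α) w), φ.toMulEquiv g ∈ torusU (starRingEnd ℂ) J ↔ g ∈ chartTorusGLoc L α w S'),
      -- (0) `Ψ ⟦y⟧ = ⟦φ y⟧`
      (∀ y : ↥(archLocal L 3 (Matrix.diagonal α) w),
        cosetCongr φ.toMulEquiv (chartTorusGLoc L α w S') (torusU (starRingEnd ℂ) J) hφT (QuotientGroup.mk y) = QuotientGroup.mk (φ y)) ∧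
      -- (i) torus clause at the local chart, (e3-3)'s `hd` ∕ `ht`
      (∀ cw : Fin 3 → ℝ,
        glDiagonal 3 ℂ (fun i => Units.mk0 (boostEig cw i) (boostEig_ne_zero cw i)) =
            ((φ (gprimeBlockAt L α w S' cw) : ↥(unitaryGroupOfForm (starRingEnd ℂ) J)) : GL (Fin 3) ℂ) ∧
          φ (gprimeBlockAt L α w S' cw) ∈ torusU (starRingEnd ℂ) J) ∧
      -- (ii) measure transport
      (∀ (μ : Measure (↥(archLocal L 3 (Matrix.diagonal α) w) ⧸ chartTorusGLoc L α w S'))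
          [SMulInvariantMeasure ↥(archLocal L 3 (Matrix.diagonal α) w) (↥(archLocal L 3 (Matrix.diagonal α) w) ⧸ chartTorusGLoc L α w S') μ]
          [IsFiniteMeasureOnCompacts μ], μ ≠ 0 →
        SMulInvariantMeasure ↥(unitaryGroupOfForm (starRingEnd ℂ) J) (↥(unitaryGroupOfForm (starRingEnd ℂ) J) ⧸ torusU (starRingEnd ℂ) J)
            (μ.map (cosetCongr φ.toMulEquiv (chartTorusGLoc L α w S') (torusU (starRingEnd ℂ) J) hφT)) ∧
          IsFiniteMeasureOnCompacts (μ.map (cosetCongr φ.toMulEquiv (chartTorusGLoc L α w S') (torusU (starRingEnd ℂ) J) hφT)) ∧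
          μ.map (cosetCongr φ.toMulEquiv (chartTorusGLoc L α w S') (torusU (starRingEnd ℂ) J) hφT) ≠ 0) ∧
      -- (iii) the orbital identity (Bochner) and its `lintegral` twin, for ANY measure `μ`
      (∀ (cw : Fin 3 → ℝ) (hT : φ (gprimeBlockAt L α w S' cw) ∈ torusU (starRingEnd ℂ) J) {E : Type} [NormedAddCommGroup E] [NormedSpace ℝ E]
          (F : ↥(unitaryGroupOfForm (starRingEnd ℂ) J) → E) (μ : Measure (↥(archLocal L 3 (Matrix.diagonal α) w) ⧸ chartTorusGLoc L α w S')),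
        ∫ x, descConj (gprimeBlockAt L α w S' cw) (chartTorusGLoc L α w S') (forall_mem_chartTorusGLoc_comm L α w S' cw) (F ∘ φ) x ∂μ =
          ∫ y, descConj (φ (gprimeBlockAt L α w S' cw)) (torusU (starRingEnd ℂ) J) (LineRing.forall_mem_torusU_comm (starRingEnd ℂ) J hT) F y
            ∂(μ.map (cosetCongr φ.toMulEquiv (chartTorusGLoc L α w S') (torusU (starRingEnd ℂ) J) hφT))) ∧
      (∀ (cw : Fin 3 → ℝ) (hT : φ (gprimeBlockAt L α w S' cw) ∈ torusU (starRingEnd ℂ) J)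
          (F : ↥(unitaryGroupOfForm (starRingEnd ℂ) J) → ℝ≥0∞) (μ : Measure (↥(archLocal L 3 (Matrix.diagonal α) w) ⧸ chartTorusGLoc L α w S')),
        ∫⁻ x, descConj (gprimeBlockAt L α w S' cw) (chartTorusGLoc L α w S') (forall_mem_chartTorusGLoc_comm L α w S' cw) (F ∘ φ) x ∂μ =
          ∫⁻ y, descConj (φ (gprimeBlockAt L α w S' cw)) (torusU (starRingEnd ℂ) J) (LineRing.forall_mem_torusU_comm (starRingEnd ℂ) J hT) F y
            ∂(μ.map (cosetCongr φ.toMulEquiv (chartTorusGLoc L α w S') (torusU (starRingEnd ℂ) J) hφT))) ∧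
      -- (iv) the POINTWISE readings: conjugation through `φ`, and the orbital integrand through `Ψ`
      (∀ (y : ↥(archLocal L 3 (Matrix.diagonal α) w)) (cw : Fin 3 → ℝ),
        φ (y * gprimeBlockAt L α w S' cw * y⁻¹) = φ y * φ (gprimeBlockAt L α w S' cw) * (φ y)⁻¹) ∧
      (∀ (cw : Fin 3 → ℝ) (hT : φ (gprimeBlockAt L α w S' cw) ∈ torusU (starRingEnd ℂ) J) {α' : Type} (F : ↥(unitaryGroupOfForm (starRingEnd ℂ) J) → α')
          (x : ↥(archLocal L 3 (Matrix.diagonal α) w) ⧸ chartTorusGLoc L α w S'),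
        descConj (φ (gprimeBlockAt L α w S' cw)) (torusU (starRingEnd ℂ) J) (LineRing.forall_mem_torusU_comm (starRingEnd ℂ) J hT) F
            (cosetCongr φ.toMulEquiv (chartTorusGLoc L α w S') (torusU (starRingEnd ℂ) J) hφT x) =
          descConj (gprimeBlockAt L α w S' cw) (chartTorusGLoc L α w S') (forall_mem_chartTorusGLoc_comm L α w S' cw) (F ∘ φ) x) := by
  obtain ⟨φ, hφ, -, hφT⟩ := exists_continuousMulEquiv_archLocal_splitChart_torusU L α w hα hsp hJ
  have hφT' : ∀ g : ↥(archLocal L 3 (Matrix.diagonal α) w), φ.toMulEquiv g ∈ torusU (starRingEnd ℂ) J ↔ g ∈ chartTorusGLoc L α w S' := hφT S' hS' hw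
  have he : Continuous φ.toMulEquiv := φ.continuous
  have hes : Continuous φ.toMulEquiv.symm := φ.symm.continuous
  refine ⟨φ, hφT', fun y => rfl, fun cw => ⟨(hφ S' (fun _ => cw) hw).2.1, (hφ S' (fun _ => cw) hw).2.2⟩, fun μ _ _ hμ => ⟨?_, ?_, ?_⟩, fun cw hT E _ _ F μ => ?_,
    fun cw hT F μ => ?_, fun y cw => by rw [map_mul, map_mul, map_inv], fun cw hT α' F x => ?_⟩
  · exact smulInvariantMeasure_map_cosetCongr_of_smulInvariantMeasure φ.toMulEquiv _ _ hφT' he μ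
  · exact isFiniteMeasureOnCompacts_map_cosetCongr φ.toMulEquiv _ _ hφT' he hes μ
  · exact map_cosetCongr_subgroup_ne_zero φ.toMulEquiv he _ _ hφT' hμ
  · exact (integral_descConj_map_cosetCongr_subgroup φ.toMulEquiv he hes _ _ hφT' μ (forall_mem_chartTorusGLoc_comm L α w S' cw)
      (LineRing.forall_mem_torusU_comm (starRingEnd ℂ) J hT) F).symm
  · exact (lintegral_descConj_map_cosetCongr_subgroup φ.toMulEquiv he hes _ _ hφT' μ (forall_mem_chartTorusGLoc_comm L α w S' cw)
      (LineRing.forall_mem_torusU_comm (starRingEnd ℂ) J hT) F).symm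
  · exact descConj_cosetCongr_subgroup φ.toMulEquiv _ _ hφT' (forall_mem_chartTorusGLoc_comm L α w S' cw) (LineRing.forall_mem_torusU_comm (starRingEnd ℂ) J hT) F x

/-- **LOCAL TRANSPORT + (e3-1): THE `hμC` OF THE TRANSPORTED LOCAL QUOTIENT MEASURE** (brick (A2) ∘ ★ `exists_measure_quotient_torusU_complex_three_eq_smul_map`).  Same `φ`, `hφT`,
`Ψ = cosetCongr φ …` as `exists_splitPlace_transport` (clauses (0), (i), (iii) re-exported), and: for every compact `K ≤ U(J₃)` with `U(J₃) = K B`, Haar `κ`, `μ_N`, and every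
`U(α)_w`-invariant Radon `μ ≠ 0` on `U(α)_w ⧸ T′_{S′,w}`, **`Ψ_* μ = C • ((k, n) ↦ k n T)_* (κ ⊗ μ_N)` with `0 < C`** — the `hμC` binder of ★ (e3-3) ∕ (e3-4a) ∕ (A3) for the split factor at `w`.
[cite: Gelbart1975, Thm. 9.22 (iii)] [cite: DeitmarEchterhoff2014, Thm. 1.5.3] [cite: Rogawski1990, §3.6 p. 31; §4.13 pp. 64–67] -/
theorem exists_splitPlace_transport_smul_map (hα : ∀ i, α i ≠ 0) (hsp : w ∈ splitChartPlaces L α)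
    (S' : Finset {w : InfinitePlace L // IsComplex w}) (hS' : ∀ v, v ∈ S' → v ∈ splitChartPlaces L α) (hw : w ∈ S')
    {J : Matrix (Fin 3) (Fin 3) ℂ} (hJ : J = (StdForm.antidiagonal 3).over ℂ)
    [MeasurableSpace ↥(archLocal L 3 (Matrix.diagonal α) w)] [BorelSpace ↥(archLocal L 3 (Matrix.diagonal α) w)]
    [MeasurableSpace ↥(unitaryGroupOfForm (starRingEnd ℂ) J)] [BorelSpace ↥(unitaryGroupOfForm (starRingEnd ℂ) J)]
    [MeasurableSpace (↥(archLocal L 3 (Matrix.diagonal α) w) ⧸ chartTorusGLoc L α w S')] [BorelSpace (↥(archLocal L 3 (Matrix.diagonal α) w) ⧸ chartTorusGLoc L α w S')]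
    [MeasurableSpace (↥(unitaryGroupOfForm (starRingEnd ℂ) J) ⧸ torusU (starRingEnd ℂ) J)] [BorelSpace (↥(unitaryGroupOfForm (starRingEnd ℂ) J) ⧸ torusU (starRingEnd ℂ) J)] :
    ∃ (φ : ↥(archLocal L 3 (Matrix.diagonal α) w) ≃ₜ* ↥(unitaryGroupOfForm (starRingEnd ℂ) J))
      (hφT : ∀ g : ↥(archLocal L 3 (Matrix.diagonal α) w), φ.toMulEquiv g ∈ torusU (starRingEnd ℂ) J ↔ g ∈ chartTorusGLoc L α w S'),
      (∀ y : ↥(archLocal L 3 (Matrix.diagonal α) w),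
        cosetCongr φ.toMulEquiv (chartTorusGLoc L α w S') (torusU (starRingEnd ℂ) J) hφT (QuotientGroup.mk y) = QuotientGroup.mk (φ y)) ∧
      (∀ cw : Fin 3 → ℝ,
        glDiagonal 3 ℂ (fun i => Units.mk0 (boostEig cw i) (boostEig_ne_zero cw i)) =
            ((φ (gprimeBlockAt L α w S' cw) : ↥(unitaryGroupOfForm (starRingEnd ℂ) J)) : GL (Fin 3) ℂ) ∧
          φ (gprimeBlockAt L α w S' cw) ∈ torusU (starRingEnd ℂ) J) ∧
      (∀ (cw : Fin 3 → ℝ) (hT : φ (gprimeBlockAt L α w S' cw) ∈ torusU (starRingEnd ℂ) J) {E : Type} [NormedAddCommGroup E] [NormedSpace ℝ E]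
          (F : ↥(unitaryGroupOfForm (starRingEnd ℂ) J) → E) (μ : Measure (↥(archLocal L 3 (Matrix.diagonal α) w) ⧸ chartTorusGLoc L α w S')),
        ∫ x, descConj (gprimeBlockAt L α w S' cw) (chartTorusGLoc L α w S') (forall_mem_chartTorusGLoc_comm L α w S' cw) (F ∘ φ) x ∂μ =
          ∫ y, descConj (φ (gprimeBlockAt L α w S' cw)) (torusU (starRingEnd ℂ) J) (LineRing.forall_mem_torusU_comm (starRingEnd ℂ) J hT) F y
            ∂(μ.map (cosetCongr φ.toMulEquiv (chartTorusGLoc L α w S') (torusU (starRingEnd ℂ) J) hφT))) ∧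
      (∀ {K : Subgroup ↥(unitaryGroupOfForm (starRingEnd ℂ) J)} (_hK : IsCompact (K : Set ↥(unitaryGroupOfForm (starRingEnd ℂ) J)))
          (_hKB : ∀ g : ↥(unitaryGroupOfForm (starRingEnd ℂ) J), ∃ k ∈ K, ∃ b ∈ borelU (starRingEnd ℂ) J, g = k * b)
          (κ : Measure ↥K) [IsHaarMeasure κ] (μN : Measure ↥(unipotentU (starRingEnd ℂ) J)) [IsHaarMeasure μN]
          (μ : Measure (↥(archLocal L 3 (Matrix.diagonal α) w) ⧸ chartTorusGLoc L α w S'))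
          [SMulInvariantMeasure ↥(archLocal L 3 (Matrix.diagonal α) w) (↥(archLocal L 3 (Matrix.diagonal α) w) ⧸ chartTorusGLoc L α w S') μ]
          [IsFiniteMeasureOnCompacts μ], μ ≠ 0 →
        ∃ C : ℝ≥0, 0 < C ∧ μ.map (cosetCongr φ.toMulEquiv (chartTorusGLoc L α w S') (torusU (starRingEnd ℂ) J) hφT) = C • Measure.map
          (fun p : ↥K × ↥(unipotentU (starRingEnd ℂ) J) =>
            (QuotientGroup.mk ((p.1 : ↥(unitaryGroupOfForm (starRingEnd ℂ) J)) * (p.2 : ↥(unitaryGroupOfForm (starRingEnd ℂ) J))) :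
              ↥(unitaryGroupOfForm (starRingEnd ℂ) J) ⧸ torusU (starRingEnd ℂ) J))
          (κ.prod μN)) := by
  obtain ⟨φ, hφT, h0, h1, h2, h3, -, -, -⟩ := exists_splitPlace_transport L α w hα hsp S' hS' hw hJ
  refine ⟨φ, hφT, h0, h1, h3, fun {K} hK hKB κ _ μN _ μ _ _ hμ => ?_⟩
  obtain ⟨hinv, hfin, hne⟩ := h2 μ hμ
  haveI := hinv
  haveI := hfin
  haveI : LocallyCompactSpace ↥(unitaryGroupOfForm (starRingEnd ℂ) J) := locallyCompactSpace_unitaryGroupOfForm_complex J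
  have hT : IsClosed (torusU (starRingEnd ℂ) J : Set ↥(unitaryGroupOfForm (starRingEnd ℂ) J)) := isClosed_torusU_of_t1Space _ _
  haveI : LocallyCompactSpace ↥(torusU (starRingEnd ℂ) J) := hT.isClosedEmbedding_subtypeVal.locallyCompactSpace
  obtain ⟨αT, hαT⟩ : ∃ αT : Measure ↥(torusU (starRingEnd ℂ) J), αT.IsHaarMeasure := ⟨Measure.haar, inferInstance⟩
  exact exists_measure_quotient_torusU_complex_three_eq_smul_map hJ hK hKB κ αT μN _ hne

end SplitPlace

end UnitaryGroup

end Literature.NumberTheory.Automorphic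

end
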